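import Literature.Geometry.GaugeTheory.SelfDualPart
import Literature.Geometry.GaugeTheory.AdaptedFramesCanonicalConnection
import Literature.Geometry.Kaehler.LocalFormsGlue
import Literature.Geometry.Kaehler.ManifoldFormsEval
import HarnessLib

/-!
# The self-dual curvature `F_A⁺` of a unitary connection as a perturbation:
# `(A, 0)` solves the Seiberg–Witten equations `(SW_η)` with `η = F_A⁺`

Topic `Literature/Geometry/GaugeTheory`; continues `SelfDualPart` (the frame-wise self-dual part
`sdPart g Φ e` of a real 2-map at a point, independent of the positive orthonormal frame),
`SeibergWittenEquations` / `SeibergWittenChartIndependence` (`Perturbation`, `IsSolution`,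
`curvatureMatrix`, `curvature_chart_eq`) and the manifold-forms slice of `Literature/Geometry/Kaehler`
(`MForm.SmoothAt`, `MForm.SmoothAt.mextDeriv`, `MForm.SmoothAt.fun_smul`).

For a unitary connection `A` on `det P̃` of a `Spin^c` structure `𝔰` the local curvature 2-forms
`dA_i` agree on overlaps (`curvature_chart_eq`), so they define **a global smooth 2-form `F_A`**
(`curvatureForm`; Morgan 1996, §3.2, Example (i): "The two-form `dω` on `P` is pulled up from a two-form
`Ω` on `X` … the curvature form"), and its **self-dual part `F_A⁺`** (`sdCurvatureForm`, computed at
each point in the frame of some chart — any chart, `sdCurvatureForm_eq`) is a smooth `g`-self-dual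
2-form, i.e. a `Perturbation` (`selfDualCurvaturePerturbation`).  Tautologically **`(A, 0)` solves
`(SW_η)` for `η = F_A⁺`** (`isSolution_ofConnection_selfDualCurvaturePerturbation`: `F_A⁺ = q(0) + F_A⁺`,
`∂_A 0 = 0`; Morgan 1996, §4.1 "The first equation simply says that this self-dual two-form is the
self-dual part of the curvature", §6.1 `(SW_h)`), which is the perturbation `P₊F_{A₀}` of Taubes's
family (5.2) (Taubes 1995, §5 Step 1).

The analytic content is the **smoothness of `F_A⁺`** (`smoothAt_sdCurvatureForm`): near a point of
`U_i`, `F_A⁺ = Σ_{a,b} c_ab e^a ∧ e^b` with `c_ab = ((Ω + ⋆Ω)_ab)/4`, `Ω_ab = dA_i(e_a, e_b)` smooth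
(a smooth form on smooth fields, `smoothAt_apply_sections`) and `e^a ∧ e^b` smooth
(`smoothAt_wedge_coframe`: in the chart, the wedge — a bounded bilinear map,
`isBoundedBilinearMap_modelWedge` — of the smooth covector fields `w ↦ g(e.symmL w, e_a)`).

PROVED, 0 named facts.

## References

* J. W. Morgan, *The Seiberg–Witten Equations and Applications to the Topology of Smooth
  Four-Manifolds* (1996), §3.2 Example (i), Lemma 2.3.4, §4.1, §6.1. [MorganSWBook1996]
* C. H. Taubes, *The Seiberg–Witten and Gromov invariants*, Math. Res. Lett. 2 (1995), §5 Step 1.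
  [Taubes1995]
-/

noncomputable section

open scoped Manifold ContDiff Topology Bundle
open Set Function Filter Bundle
open Literature.Geometry.Lorentzian (PseudoRiemannianMetric contMDiffAt_clm_apply_iff)
open Literature.Topology.FourManifolds (SmoothOrientation)
open Literature.Geometry.Kaehler (MForm IsSmoothForm mextDeriv)

namespace Literature.Geometry.GaugeTheory

/-- Local notation: the model space `ℝ⁴`. -/
local notation "𝔼⁴" => EuclideanSpace ℝ (Fin 4)

/-! ### The wedge of covectors on the model space is a bounded bilinear map -/

section Model

/-- **The wedge `θ₁ ∧ θ₂` of two covectors on the model space `ℝ⁴`** (same formula as `wedgeCLM`).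
[folklore] -/
def modelWedge (θ₁ θ₂ : 𝔼⁴ →L[ℝ] ℝ) : 𝔼⁴ [⋀^Fin 2]→L[ℝ] ℝ :=
  ContinuousMultilinearMap.alternatization
    ((ContinuousMultilinearMap.mkPiAlgebra ℝ (Fin 2) ℝ).compContinuousLinearMap ![θ₁, θ₂])

/-- `(θ₁ ∧ θ₂)(v₀, v₁) = θ₁(v₀)θ₂(v₁) - θ₁(v₁)θ₂(v₀)`. [folklore] -/
theorem modelWedge_apply (θ₁ θ₂ : 𝔼⁴ →L[ℝ] ℝ) (v : Fin 2 → 𝔼⁴) :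
    modelWedge θ₁ θ₂ v = θ₁ (v 0) * θ₂ (v 1) - θ₁ (v 1) * θ₂ (v 0) := by
  simp only [modelWedge, ContinuousMultilinearMap.alternatization_apply_apply]
  have huniv : (Finset.univ : Finset (Equiv.Perm (Fin 2))) = {1, Equiv.swap 0 1} := by decide
  rw [huniv, Finset.sum_pair (by decide)]
  simp [Equiv.Perm.sign_swap', Units.smul_def, Fin.prod_univ_two, sub_eq_add_neg]

/-- **The wedge is a bounded bilinear map** `(θ₁, θ₂) ↦ θ₁ ∧ θ₂` (`|θ₁ ∧ θ₂| ≤ 2|θ₁||θ₂|`), hence `C^∞`.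
[folklore] -/
theorem isBoundedBilinearMap_modelWedge :
    IsBoundedBilinearMap ℝ fun p : (𝔼⁴ →L[ℝ] ℝ) × (𝔼⁴ →L[ℝ] ℝ) ↦ modelWedge p.1 p.2 where
  add_left θ₁ θ₁' θ₂ := by
    ext v; simp only [modelWedge_apply, add_apply, ContinuousAlternatingMap.add_apply]; ring
  smul_left c θ₁ θ₂ := by
    ext v; simp only [modelWedge_apply, smul_apply, ContinuousAlternatingMap.smul_apply, smul_eq_mul]; ring
  add_right θ₁ θ₂ θ₂' := by
    ext v; simp only [modelWedge_apply, add_apply, ContinuousAlternatingMap.add_apply]; ring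
  smul_right c θ₁ θ₂ := by
    ext v; simp only [modelWedge_apply, smul_apply, ContinuousAlternatingMap.smul_apply, smul_eq_mul]; ring
  bound := by
    refine ⟨2, two_pos, fun θ₁ θ₂ ↦ ?_⟩
    refine (modelWedge θ₁ θ₂).opNorm_le_bound (by positivity) fun v ↦ ?_
    rw [modelWedge_apply, Fin.prod_univ_two, Real.norm_eq_abs]
    have h1 := θ₁.le_opNorm (v 0)
    have h2 := θ₂.le_opNorm (v 1)
    have h3 := θ₁.le_opNorm (v 1)
    have h4 := θ₂.le_opNorm (v 0)
    rw [Real.norm_eq_abs] at h1 h2 h3 h4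
    calc |θ₁ (v 0) * θ₂ (v 1) - θ₁ (v 1) * θ₂ (v 0)|
        ≤ |θ₁ (v 0)| * |θ₂ (v 1)| + |θ₁ (v 1)| * |θ₂ (v 0)| := by
          rw [← abs_mul, ← abs_mul]; exact abs_sub _ _
      _ ≤ ‖θ₁‖ * ‖v 0‖ * (‖θ₂‖ * ‖v 1‖) + ‖θ₁‖ * ‖v 1‖ * (‖θ₂‖ * ‖v 0‖) :=
          add_le_add (mul_le_mul h1 h2 (abs_nonneg _) (by positivity))
            (mul_le_mul h3 h4 (abs_nonneg _) (by positivity))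
      _ = 2 * ‖θ₁‖ * ‖θ₂‖ * (‖v 0‖ * ‖v 1‖) := by ring

end Model

section Bundle

variable {X : Type*} [TopologicalSpace X] [ChartedSpace 𝔼⁴ X] [IsManifold (𝓡 4) ∞ X]
  (g : PseudoRiemannianMetric (𝓡 4) ∞ 𝔼⁴ (TangentSpace (𝓡 4) : X → Type _))

/-! ### Smooth forms evaluated on smooth fields, local version -/

omit [IsManifold (𝓡 4) ∞ X] in
/-- **A form smooth at `x₀` evaluated on vector fields smooth at `x₀` is smooth at `x₀`** (local form
of the tree's `IsSmoothForm.contMDiffAt_apply_sections`, same proof: read the form in the chart at `x₀`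
and the fields in the trivialisation of `TX` at `x₀`). [cite: LeeSmoothManifolds2013, Prop. 14.26] -/
theorem smoothAt_apply_sections [IsManifold (𝓡 4) ∞ X] {k : ℕ} {α : MForm (𝓡 4) X ℝ k} {x₀ : X}
    (hα : α.SmoothAt x₀) {V : Fin k → Π x : X, TangentSpace (𝓡 4) x}
    (hV : ∀ i, ContMDiffAt (𝓡 4) ((𝓡 4).prod 𝓘(ℝ, 𝔼⁴)) ∞
      (fun x ↦ (TotalSpace.mk' 𝔼⁴ x (V i x) : TangentBundle (𝓡 4) X)) x₀) :
    ContMDiffAt (𝓡 4) 𝓘(ℝ, ℝ) ∞ (fun x ↦ α x fun i ↦ V i x) x₀ := by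
  set e := trivializationAt 𝔼⁴ (TangentSpace (𝓡 4) : X → Type _) x₀ with he
  have hx₀ : x₀ ∈ e.baseSet := FiberBundle.mem_baseSet_trivializationAt' x₀
  have hw : ∀ i, ContMDiffAt (𝓡 4) 𝓘(ℝ, 𝔼⁴) ∞ (fun x ↦ (e ⟨x, V i x⟩).2) x₀ := fun i ↦
    (e.contMDiffAt_section_iff hx₀).1 (hV i)
  have hwpi : ContMDiffAt (𝓡 4) 𝓘(ℝ, Fin k → 𝔼⁴) ∞ (fun x ↦ fun i ↦ (e ⟨x, V i x⟩).2) x₀ :=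
    contMDiffAt_pi_space.2 hw
  have hsrc : (extChartAt (𝓡 4) x₀).source ∈ 𝓝 x₀ := extChartAt_source_mem_nhds x₀
  have hG : ContDiffAt ℝ ∞ (α.inChart x₀) (extChartAt (𝓡 4) x₀ x₀) := by
    have h : ContDiffWithinAt ℝ ∞ (α.inChart x₀) (range (𝓡 4)) (extChartAt (𝓡 4) x₀ x₀) := hα
    rw [ModelWithCorners.Boundaryless.range_eq_univ (I := 𝓡 4)] at h
    exact h.contDiffAt univ_mem
  have hGφ : ContMDiffAt (𝓡 4) 𝓘(ℝ, 𝔼⁴ [⋀^Fin k]→L[ℝ] ℝ) ∞ (fun x ↦ α.inChart x₀ (extChartAt (𝓡 4) x₀ x)) x₀ :=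
    hG.comp_contMDiffAt (contMDiffAt_extChartAt' (mem_chart_source 𝔼⁴ x₀))
  have hcomp : ContMDiffAt (𝓡 4) 𝓘(ℝ, ℝ) ∞
      (fun x ↦ (α.inChart x₀ (extChartAt (𝓡 4) x₀ x)) fun i ↦ (e ⟨x, V i x⟩).2) x₀ :=
    Literature.Geometry.Kaehler.contDiff_continuousAlternatingMap_uncurry.comp_contMDiffAt (hGφ.prodMk_space hwpi)
  refine hcomp.congr_of_eventuallyEq ?_
  filter_upwards [hsrc] with x hx
  exact α.apply_eq_inChart_trivializationAt x₀ hx _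

/-! ### Smoothness of `e^a ∧ e^b` for smooth fields `e_a`, `e_b` -/

omit [IsManifold (𝓡 4) ∞ X] in
/-- Values of `wedgeCLM` on an arbitrary pair. [folklore] -/
theorem wedgeCLM_apply' {x : X} (θ₁ θ₂ : TangentSpace (𝓡 4) x →L[ℝ] ℝ) (v : Fin 2 → TangentSpace (𝓡 4) x) :
    wedgeCLM θ₁ θ₂ v = θ₁ (v 0) * θ₂ (v 1) - θ₁ (v 1) * θ₂ (v 0) := by
  have hv : v = ![v 0, v 1] := by funext k; fin_cases k <;> rfl
  conv_lhs => rw [hv]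
  exact wedgeCLM_apply θ₁ θ₂ (v 0) (v 1)

/-- **The covector field `w ↦ g_x(e.symmL x w, W x)` is smooth at `x₀`** (in the coordinate frame of
the tangent trivialization `e` at `x₀`), for a field `W` smooth at `x₀`. [folklore] -/
theorem contMDiffAt_coframeCLM_comp_symmL {x₀ : X} {W : Π x : X, TangentSpace (𝓡 4) x}
    (hW : ContMDiffAt (𝓡 4) ((𝓡 4).prod 𝓘(ℝ, 𝔼⁴)) ∞
      (fun x : X ↦ TotalSpace.mk' 𝔼⁴ (E := (TangentSpace (𝓡 4) : X → Type _)) x (W x)) x₀) :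
    ContMDiffAt (𝓡 4) 𝓘(ℝ, 𝔼⁴ →L[ℝ] ℝ) ∞ (fun x ↦ (coframeCLM g (W x)).comp
      ((trivializationAt 𝔼⁴ (TangentSpace (𝓡 4) : X → Type _) x₀).symmL ℝ x)) x₀ := by
  rw [contMDiffAt_clm_apply_iff]
  intro w
  exact g.contMDiffAt_val_apply le_rfl (contMDiffAt_symmL_trivializationAt x₀ w) hW

/-- **The 2-form `x ↦ g(·, V x) ∧ g(·, W x)` is smooth at `x₀`** for fields `V`, `W` smooth at `x₀`:
its chart representative at `x₀` is the wedge (a bounded bilinear map) of the smooth covector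
fields of `contMDiffAt_coframeCLM_comp_symmL`, the inverse extended chart having derivative
`e.symmL` (`TangentBundle.symmL_trivializationAt`). [folklore] -/
theorem smoothAt_wedge_coframe {x₀ : X} {V W : Π x : X, TangentSpace (𝓡 4) x}
    (hV : ContMDiffAt (𝓡 4) ((𝓡 4).prod 𝓘(ℝ, 𝔼⁴)) ∞
      (fun x : X ↦ TotalSpace.mk' 𝔼⁴ (E := (TangentSpace (𝓡 4) : X → Type _)) x (V x)) x₀)
    (hW : ContMDiffAt (𝓡 4) ((𝓡 4).prod 𝓘(ℝ, 𝔼⁴)) ∞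
      (fun x : X ↦ TotalSpace.mk' 𝔼⁴ (E := (TangentSpace (𝓡 4) : X → Type _)) x (W x)) x₀) :
    MForm.SmoothAt (fun x ↦ wedgeCLM (coframeCLM g (V x)) (coframeCLM g (W x)) : MForm (𝓡 4) X ℝ 2) x₀ := by
  set α : MForm (𝓡 4) X ℝ 2 := fun x ↦ wedgeCLM (coframeCLM g (V x)) (coframeCLM g (W x)) with hα
  obtain ⟨FV, hFV⟩ : ∃ F : X → 𝔼⁴ →L[ℝ] ℝ, F = fun x ↦ (coframeCLM g (V x)).comp
      ((trivializationAt 𝔼⁴ (TangentSpace (𝓡 4) : X → Type _) x₀).symmL ℝ x) := ⟨_, rfl⟩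
  obtain ⟨FW, hFW⟩ : ∃ F : X → 𝔼⁴ →L[ℝ] ℝ, F = fun x ↦ (coframeCLM g (W x)).comp
      ((trivializationAt 𝔼⁴ (TangentSpace (𝓡 4) : X → Type _) x₀).symmL ℝ x) := ⟨_, rfl⟩
  have hFVs : ContMDiffAt (𝓡 4) 𝓘(ℝ, 𝔼⁴ →L[ℝ] ℝ) ∞ FV x₀ := hFV ▸ contMDiffAt_coframeCLM_comp_symmL g hV
  have hFWs : ContMDiffAt (𝓡 4) 𝓘(ℝ, 𝔼⁴ →L[ℝ] ℝ) ∞ FW x₀ := hFW ▸ contMDiffAt_coframeCLM_comp_symmL g hW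
  have hG : ContMDiffAt (𝓡 4) 𝓘(ℝ, 𝔼⁴ [⋀^Fin 2]→L[ℝ] ℝ) ∞
      ((fun p : (𝔼⁴ →L[ℝ] ℝ) × (𝔼⁴ →L[ℝ] ℝ) ↦ modelWedge p.1 p.2) ∘ fun x ↦ (FV x, FW x)) x₀ :=
    isBoundedBilinearMap_modelWedge.contDiff.comp_contMDiffAt (hFVs.prodMk_space hFWs)
  have hG' : ContDiffWithinAt ℝ ∞
      (((fun p : (𝔼⁴ →L[ℝ] ℝ) × (𝔼⁴ →L[ℝ] ℝ) ↦ modelWedge p.1 p.2) ∘ fun x ↦ (FV x, FW x)) ∘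
        (extChartAt (𝓡 4) x₀).symm) (range (𝓡 4)) (extChartAt (𝓡 4) x₀ x₀) := by
    simpa using (contMDiffAt_iff.1 hG).2
  have hev : ∀ y ∈ (extChartAt (𝓡 4) x₀).target, α.inChart x₀ y =
      modelWedge (FV ((extChartAt (𝓡 4) x₀).symm y)) (FW ((extChartAt (𝓡 4) x₀).symm y)) := by
    intro y hy
    have hx : (extChartAt (𝓡 4) x₀).symm y ∈ (chartAt 𝔼⁴ x₀).source := by
      rw [← extChartAt_source (𝓡 4)]
      exact (extChartAt (𝓡 4) x₀).map_target hy
    have hD : mfderivWithin 𝓘(ℝ, 𝔼⁴) (𝓡 4) (extChartAt (𝓡 4) x₀).symm (range (𝓡 4)) y =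
        (trivializationAt 𝔼⁴ (TangentSpace (𝓡 4) : X → Type _) x₀).symmL ℝ ((extChartAt (𝓡 4) x₀).symm y) := by
      rw [TangentBundle.symmL_trivializationAt hx, (extChartAt (𝓡 4) x₀).right_inv hy]
    ext v
    rw [Literature.Geometry.Kaehler.MForm.inChart_apply, hD, modelWedge_apply]
    simp only [hα, hFV, hFW, wedgeCLM_apply', ContinuousLinearMap.comp_apply, coframeCLM_apply]
    rfl
  unfold MForm.SmoothAt
  refine hG'.congr_of_eventuallyEq ?_ (hev _ (mem_extChartAt_target x₀))
  filter_upwards [extChartAt_target_mem_nhdsWithin x₀] with y hy using hev y hy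

omit [IsManifold (𝓡 4) ∞ X] in
/-- Finite sums of forms smooth at a point are smooth at the point. [folklore] -/
theorem MForm.smoothAt_finset_sum {k : ℕ} {κ : Type*} (s : Finset κ) {f : κ → MForm (𝓡 4) X ℝ k} {x : X}
    (h : ∀ a ∈ s, (f a).SmoothAt x) : (∑ a ∈ s, f a).SmoothAt x := by
  classical
  induction s using Finset.induction_on with
  | empty => simpa using Literature.Geometry.Kaehler.MForm.smoothAt_zero (I := 𝓡 4) (F := ℝ) (k := k) x
  | insert a s ha ih =>
    rw [Finset.sum_insert ha]
    exact (h a (Finset.mem_insert_self a s)).add (ih fun b hb ↦ h b (Finset.mem_insert_of_mem hb))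

/-! ### The curvature 2-form of a unitary connection on `det P̃` -/

variable (o : SmoothOrientation (𝓡 4) X) {ι : Type*}

namespace SpincStructure

variable {g o} (𝔰 : SpincStructure g o ι)

/-- **The local curvature 2-form `dA_i`** of the chart `i`, as an `MForm` (its values are
`A.curvature i`). [cite: MorganSWBook1996, §3.2 Example (i)] -/
def curvForm (A : 𝔰.detLineBundle.Connection) (i : ι) : MForm (𝓡 4) X ℝ 2 :=
  mextDeriv (A.form i).toMForm

/-- `dA_i(u, v) = A.curvature i x u v`. [folklore] -/
@[simp] theorem curvForm_apply (A : 𝔰.detLineBundle.Connection) (i : ι) (x : X) (u v : TangentSpace (𝓡 4) x) :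
    𝔰.curvForm A i x ![u, v] = A.curvature i x u v := rfl

/-- **`dA_j = dA_i` on `U_i ∩ U_j`** (as alternating maps; `curvature_chart_eq`). [cite: MorganSWBook1996, §3.2 Example (i)] -/
theorem curvForm_chart_eq (A : 𝔰.detLineBundle.Connection) (i j : ι) {x : X} (hx : x ∈ 𝔰.baseSet i ∩ 𝔰.baseSet j) :
    𝔰.curvForm A j x = 𝔰.curvForm A i x := by
  ext v
  have hv : v = ![v 0, v 1] := by funext k; fin_cases k <;> rfl
  rw [hv]
  exact 𝔰.curvature_chart_eq A i j hx (v 0) (v 1)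

/-- `dA_i` is smooth at the points of `U_i` (`A_i` is smooth on the open `U_i`). [cite: MorganSWBook1996, §3.2] -/
theorem smoothAt_curvForm (A : 𝔰.detLineBundle.Connection) (i : ι) {x : X} (hx : x ∈ 𝔰.baseSet i) :
    (𝔰.curvForm A i).SmoothAt x :=
  Literature.Geometry.Kaehler.MForm.SmoothAt.mextDeriv (by
    filter_upwards [(𝔰.isOpen_baseSet i).mem_nhds hx] with y hy
    exact A.smoothAt_form i y hy)

/-- **The curvature 2-form `F_A`** (real: the curvature of `∇ = d + iA` is `iF_A`) as a global `MForm`: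
at `x`, the local form `dA_i` of some chart `i ∋ x` — of any chart, `curvatureForm_eq`.
[cite: MorganSWBook1996, §3.2 Example (i)] -/
def curvatureForm (A : 𝔰.detLineBundle.Connection) : MForm (𝓡 4) X ℝ 2 := fun x ↦
  𝔰.curvForm A (𝔰.indexAt x) x

/-- `F_A = dA_i` at the points of `U_i`. [cite: MorganSWBook1996, §3.2 Example (i)] -/
theorem curvatureForm_eq (A : 𝔰.detLineBundle.Connection) (i : ι) {x : X} (hx : x ∈ 𝔰.baseSet i) :
    𝔰.curvatureForm A x = 𝔰.curvForm A i x :=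
  𝔰.curvForm_chart_eq A i (𝔰.indexAt x) ⟨hx, 𝔰.mem_baseSet_indexAt x⟩

/-- `F_A(e_a, e_b) = (curvatureMatrix A i x)_ab` in the frame of the chart `i`. [cite: MorganSWBook1996, §4.1] -/
theorem twoFormMatrix_curvatureForm (A : 𝔰.detLineBundle.Connection) (i : ι) {x : X} (hx : x ∈ 𝔰.baseSet i) :
    twoFormMatrix (𝔰.curvatureForm A) x (fun k ↦ 𝔰.frame i k x) = 𝔰.curvatureMatrix A i x := by
  ext a b
  rw [twoFormMatrix_apply, curvatureMatrix_apply, 𝔰.curvatureForm_eq A i hx, curvForm_apply]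

/-- **`F_A` is smooth.** [cite: MorganSWBook1996, §3.2 Example (i)] -/
theorem smoothAt_curvatureForm (A : 𝔰.detLineBundle.Connection) (x : X) : (𝔰.curvatureForm A).SmoothAt x := by
  refine (𝔰.smoothAt_curvForm A (𝔰.indexAt x) (𝔰.mem_baseSet_indexAt x)).congr_of_eventuallyEq ?_
  filter_upwards [(𝔰.isOpen_baseSet _).mem_nhds (𝔰.mem_baseSet_indexAt x)] with y hy
  exact (𝔰.curvatureForm_eq A _ hy).symm

/-- `F_A` is a smooth form. [cite: MorganSWBook1996, §3.2 Example (i)] -/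
theorem isSmoothForm_curvatureForm (A : 𝔰.detLineBundle.Connection) : IsSmoothForm (𝔰.curvatureForm A) :=
  fun x ↦ 𝔰.smoothAt_curvatureForm A x

/-! ### The self-dual part `F_A⁺` -/

/-- **The self-dual part `F_A⁺` of the curvature** as a global 2-form: at `x`, the self-dual part
(`sdPart`) of `F_A(x)` computed in the frame of some chart at `x` — of any chart,
`sdCurvatureForm_eq`. [cite: MorganSWBook1996, §4.1] -/
def sdCurvatureForm (A : 𝔰.detLineBundle.Connection) : MForm (𝓡 4) X ℝ 2 := fun x ↦
  sdPart g (𝔰.curvatureForm A x) fun k ↦ 𝔰.frame (𝔰.indexAt x) k x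

/-- `F_A⁺(x)` is the self-dual part of `dA_i(x)` in the frame `e^{(i)}(x)`, for every chart `i ∋ x`
(frame independence of the self-dual part). [cite: MorganSWBook1996, Lemma 2.3.4] -/
theorem sdCurvatureForm_eq (A : 𝔰.detLineBundle.Connection) (i : ι) {x : X} (hx : x ∈ 𝔰.baseSet i) :
    𝔰.sdCurvatureForm A x = sdPart g (𝔰.curvForm A i x) fun k ↦ 𝔰.frame i k x := by
  rw [sdCurvatureForm, 𝔰.curvatureForm_eq A i hx]
  exact sdPart_eq_of_isPosOrthonormalFrame g o _ (𝔰.isPosOrthonormalFrame_frame _ x (𝔰.mem_baseSet_indexAt x))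
    (𝔰.isPosOrthonormalFrame_frame i x hx)

/-- **`F_A⁺(e_a, e_b) = ((Ω + ⋆Ω)/2)_ab`** with `Ω = curvatureMatrix A i x`, in the frame of the chart `i`.
[cite: MorganSWBook1996, Lemma 2.3.4] -/
theorem twoFormMatrix_sdCurvatureForm (A : 𝔰.detLineBundle.Connection) (i : ι) {x : X} (hx : x ∈ 𝔰.baseSet i) :
    twoFormMatrix (𝔰.sdCurvatureForm A) x (fun k ↦ 𝔰.frame i k x) = sdMatrix (𝔰.curvatureMatrix A i x) := by
  rw [twoFormMatrix_eq_altMatrix, 𝔰.sdCurvatureForm_eq A i hx, altMatrix_sdPart g (𝔰.isOrthonormalFrame_frame i hx),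
    ← 𝔰.twoFormMatrix_curvatureForm A i hx, twoFormMatrix_eq_altMatrix, 𝔰.curvatureForm_eq A i hx]

/-- **`F_A⁺` is `g`-self-dual** in every frame of `𝔰`. [cite: MorganSWBook1996, Lemma 2.3.4] -/
theorem isSelfDualTwo_twoFormMatrix_sdCurvatureForm (A : 𝔰.detLineBundle.Connection) (i : ι) {x : X}
    (hx : x ∈ 𝔰.baseSet i) : IsSelfDualTwo (twoFormMatrix (𝔰.sdCurvatureForm A) x fun k ↦ 𝔰.frame i k x) := by
  rw [𝔰.twoFormMatrix_sdCurvatureForm A i hx]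
  exact isSelfDualTwo_sdMatrix (𝔰.isTwoForm_curvatureMatrix A i x)

/-- **`ρ⁺(F_A⁺) = ρ⁺(F_A)`** in every chart. [cite: MorganSWBook1996, Lemma 2.3.4] -/
theorem plusAction_twoFormMatrix_sdCurvatureForm (A : 𝔰.detLineBundle.Connection) (i : ι) {x : X}
    (hx : x ∈ 𝔰.baseSet i) :
    plusAction (twoFormMatrix (𝔰.sdCurvatureForm A) x fun k ↦ 𝔰.frame i k x) = plusAction (𝔰.curvatureMatrix A i x) := by
  rw [𝔰.twoFormMatrix_sdCurvatureForm A i hx, plusAction_sdMatrix (𝔰.isTwoForm_curvatureMatrix A i x)]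

omit [IsManifold (𝓡 4) ∞ X] in
/-- The entries of `⋆M(y)` are smooth functions of `y` if those of `M(y)` are. [folklore] -/
theorem contMDiffAt_hodgeStarTwo_apply {M : X → Matrix (Fin 4) (Fin 4) ℝ} {x₀ : X}
    (hM : ∀ a b, ContMDiffAt (𝓡 4) 𝓘(ℝ, ℝ) ∞ (fun y ↦ M y a b) x₀) (a b : Fin 4) :
    ContMDiffAt (𝓡 4) 𝓘(ℝ, ℝ) ∞ (fun y ↦ hodgeStarTwo (M y) a b) x₀ := by
  fin_cases a <;> fin_cases b <;>
    simp only [hodgeStarTwo, Matrix.of_apply, Matrix.cons_val', Matrix.cons_val_zero, Matrix.cons_val_one,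
      Matrix.cons_val, Fin.isValue, Fin.mk_one, Fin.zero_eta, Fin.reduceFinMk] <;>
    first
    | exact contMDiffAt_const
    | exact hM _ _

/-- **`F_A⁺` is smooth.**  Near `x₀ ∈ U_i`: `F_A⁺ = Σ_{a,b} c_ab • (e^a ∧ e^b)` with
`c_ab = ((Ω + ⋆Ω)_ab)/4` smooth (`Ω_ab = dA_i(e_a, e_b)`, a smooth form on smooth fields) and
`e^a ∧ e^b` smooth (`smoothAt_wedge_coframe`). [cite: MorganSWBook1996, §4.1] -/
theorem smoothAt_sdCurvatureForm (A : 𝔰.detLineBundle.Connection) (x₀ : X) : (𝔰.sdCurvatureForm A).SmoothAt x₀ := by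
  set i := 𝔰.indexAt x₀ with hi
  have hx₀ : x₀ ∈ 𝔰.baseSet i := 𝔰.mem_baseSet_indexAt x₀
  -- the coefficient functions and the coframe wedges
  set M : X → Matrix (Fin 4) (Fin 4) ℝ := fun y ↦ altMatrix (𝔰.curvForm A i y) fun k ↦ 𝔰.frame i k y with hMdef
  set c : Fin 4 → Fin 4 → X → ℝ := fun a b y ↦ sdMatrix (M y) a b / 2 with hc
  set Θ : Fin 4 → Fin 4 → MForm (𝓡 4) X ℝ 2 := fun a b y ↦
    wedgeCLM (coframeCLM g (𝔰.frame i a y)) (coframeCLM g (𝔰.frame i b y)) with hΘ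
  -- `F_A⁺` is the finite sum near `x₀`
  have hev : ∀ᶠ y in 𝓝 x₀, (∑ a, ∑ b, c a b • Θ a b : MForm (𝓡 4) X ℝ 2) y = 𝔰.sdCurvatureForm A y := by
    filter_upwards [(𝔰.isOpen_baseSet i).mem_nhds hx₀] with y hy
    rw [𝔰.sdCurvatureForm_eq A i hy, sdPart, ofMatrixFrame]
    simp only [Finset.sum_apply, Pi.smul_apply', hc, hΘ, hMdef]
  -- smoothness of the entries `Ω_ab(y) = dA_i(e_a, e_b)(y)`
  have hM : ∀ a b, ContMDiffAt (𝓡 4) 𝓘(ℝ, ℝ) ∞ (fun y ↦ M y a b) x₀ := by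
    intro a b
    have h := smoothAt_apply_sections (𝔰.smoothAt_curvForm A i hx₀) (V := ![𝔰.frame i a, 𝔰.frame i b])
      (fun k ↦ by fin_cases k <;> exact 𝔰.contMDiffAt_frame i _ hx₀)
    refine h.congr_of_eventuallyEq (Eventually.of_forall fun y ↦ ?_)
    simp only [hMdef, altMatrix_apply]
    congr 1
    funext k
    fin_cases k <;> rfl
  -- smoothness of the coefficients `c_ab`
  have hcs : ∀ a b, ContMDiffAt (𝓡 4) 𝓘(ℝ, ℝ) ∞ (c a b) x₀ := by
    intro a b
    have h1 : ContMDiffAt (𝓡 4) 𝓘(ℝ, ℝ) ∞ (fun y ↦ (2⁻¹ : ℝ) * (M y a b + hodgeStarTwo (M y) a b) / 2) x₀ :=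
      ((contMDiffAt_const.mul ((hM a b).add (contMDiffAt_hodgeStarTwo_apply hM a b))).div_const 2)
    refine h1.congr_of_eventuallyEq (Eventually.of_forall fun y ↦ ?_)
    simp only [hc, sdMatrix, Matrix.smul_apply, Matrix.add_apply, smul_eq_mul]
  -- smoothness of the wedges
  have hΘs : ∀ a b, (Θ a b).SmoothAt x₀ := fun a b ↦
    smoothAt_wedge_coframe g (𝔰.contMDiffAt_frame i a hx₀) (𝔰.contMDiffAt_frame i b hx₀)
  -- conclude
  have hsum : MForm.SmoothAt (∑ a, ∑ b, c a b • Θ a b : MForm (𝓡 4) X ℝ 2) x₀ :=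
    MForm.smoothAt_finset_sum _ fun a _ ↦ MForm.smoothAt_finset_sum _ fun b _ ↦ (hΘs a b).fun_smul (hcs a b)
  exact hsum.congr_of_eventuallyEq hev

/-- `F_A⁺` is a smooth form. [cite: MorganSWBook1996, §4.1] -/
theorem isSmoothForm_sdCurvatureForm (A : 𝔰.detLineBundle.Connection) : IsSmoothForm (𝔰.sdCurvatureForm A) :=
  fun x ↦ 𝔰.smoothAt_sdCurvatureForm A x

/-- **`F_A⁺` as a perturbation** (a smooth `g`-self-dual 2-form; Morgan 1996, §6.1: the perturbed
equations are `F_A⁺ = q(ψ) + ih` with `h` a self-dual real 2-form). [cite: MorganSWBook1996, §6.1] -/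
def selfDualCurvaturePerturbation (A : 𝔰.detLineBundle.Connection) : 𝔰.Perturbation where
  form := 𝔰.sdCurvatureForm A
  isSmoothForm := 𝔰.isSmoothForm_sdCurvatureForm A
  isSelfDual i _ hx := 𝔰.isSelfDualTwo_twoFormMatrix_sdCurvatureForm A i hx

/-- The form of `selfDualCurvaturePerturbation A` is `F_A⁺` (definitional). [folklore] -/
@[simp] theorem selfDualCurvaturePerturbation_form (A : 𝔰.detLineBundle.Connection) :
    (𝔰.selfDualCurvaturePerturbation A).form = 𝔰.sdCurvatureForm A := rfl

/-- **`(A, 0)` solves `(SW_η)` with `η = F_A⁺`** — the curvature equation `ρ⁺(F_A) = q(0) + ρ⁺(F_A⁺)`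
holds tautologically (`ρ⁺` only sees the self-dual part) and `∂_A 0 = 0`: every unitary connection
is a reducible solution for the perturbation by its own self-dual curvature (Morgan 1996, §4.1, §6.1;
this is the perturbation `P₊F_{A₀}` of Taubes 1995, (5.2)). [cite: MorganSWBook1996, §6.1] -/
theorem isSolution_ofConnection_selfDualCurvaturePerturbation [g.HasLeviCivita] (A : 𝔰.detLineBundle.Connection) :
    IsSolution (𝔰.selfDualCurvaturePerturbation A) (Configuration.ofConnection A) := fun i x hx ↦
  (isSolutionAt_ofConnection_iff _ A i x).2 (by
    rw [selfDualCurvaturePerturbation_form, 𝔰.plusAction_twoFormMatrix_sdCurvatureForm A i hx])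

end SpincStructure

end Bundle

end Literature.Geometry.GaugeTheory

end
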